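import Mathlib
import HarnessLib
import Summits.HubbardSuperconductivity.HubbardSuperconductivity.Theorems.KLProgrammeKLRegimeTwoVolumeLipBaseDefs
import Summits.HubbardSuperconductivity.HubbardSuperconductivity.Theorems.KLProgrammeKLRegimeTwoVolumeSubstitutionGluingDeepPin
import Summits.HubbardSuperconductivity.HubbardSuperconductivity.Theorems.KLProgrammeKLRegimeTwoVolumeTransferTailsWt

/-!
# Route `KLProgramme` — crux K3 ENGINE (stmt-HubbardSuperconductivity-20437), stub (e) proof-input «(e)-D-ROWS», G-4 (door): THE GRID → SECTOR TRANSFER DOOR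
# AT A DEEP PIN — k3c5-p2's `sum_norm_kernel_map_sub_glue_map_le_of_defect` with INPUT block structure `klGridBlockEquiv` (grid legs) and OUTPUT `klBlockEquiv`
# (seat hubbard-kl-k3c4-p1 g24; `--supports` 20437; DROWS-SCOPE-g24 v8 §10.4; grid twins of `…LipGlueTransfer.klGlue_transfer_le` / `…LipGlueTransferRows.klGlue_transfer_le_of_wtRows`)

The base object `BD_base` of the two-volume Lipschitz tower is `map (toLin′ T_{bL}) G_{bL} − klGlue (map (toLin′ T_L) G_L)` with the base transfers
`T_V = klLipBaseTransfer V` from the GRID LEGS to the scale-0 sector labels and the UV grid actions `G_V = klGridActionZero V` (`…TwoVolumeLipBaseDefs`).  This file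
is the transfer door for such matrices: input labels `GridLeg (GridPoint V (klGridN M))` glued by `klGridGlue` (block structure route A's `klGridBlockEquiv`,
embeddings `klGridBlockEmb`), output labels `SpaceTimeIdx V M × SectorLeg N₂` glued by `klGlue` (`klBlockEquiv`, `klBlockEmb`):

* `klGridGlue_transfer_le` — the generic door with the nine transfer rows named (twin of `klGlue_transfer_le`);
* `klGridGlue_transfer_le_of_wtRows` — the nine rows and the triangle DISCHARGED from `(1 + Λ_T·tnorm)`-weighted row / column sums of `T′` (`≤ cW`) and block
  covariance, at a `(D₀+r)`-deep output pin (`2r ≤ D₀`): `≤ cWⁿ(cW·E + τ·ND) + (2cWⁿτN + n·cWⁿ(5τN + 2cW·N_far))`, `τ = cW/(1 + Λ_T(r+1))`, where `N`, `N_far` are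
  the plain / `r`-far profiles of the coarse grid element `W`, and `E` (pins within `r` of the output pin), `ND` (all pins) those of the grid defect `W′ − klGridGlue W`
  (`…TransferTailsWt` nine lemmas with the grid-leg site map `Y ↦ Y.1.1.2`, `klGridBlockEquiv_val / _snd`);
* **`lipBaseDiff_pinned_le`** — G-4: `BD_base` at a `(D₀+r)`-deep scale-0 pin from the rows of `klLipBaseTransfer (bL)` and the profiles of the UV grid actions and of
  their grid defect `klGridActionZero (bL) − klGridGlue (klGridActionZero L)` (route A's base datum).

Compositions of landed theorems; nothing asserts the (D) rows, stub (e), VL, K3 or superconductivity.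
References: BGM 2006 §2.7 (2.70)–(2.71), §3 [cite: BenfattoGiulianiMastropietro2006].
-/

namespace Summit.HubbardSuperconductivity.HubbardSuperconductivity.Theorems.TwoVolumeLip

set_option linter.dupNamespace false -- summit = problem name (single-conjunct summit), D-0017

open Finset Literature.MathematicalPhysics.QuantumLattice GrassmannAlgebra Literature.Probability.LatticeModels
open Literature.MathematicalPhysics.QuantumLattice.FermiRG
open Summit.HubbardSuperconductivity.HubbardSuperconductivity.Theorems.KLRegimeSplit
open Summit.HubbardSuperconductivity.HubbardSuperconductivity.Theorems.KLProgrammeLegKernels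
open Summit.HubbardSuperconductivity.HubbardSuperconductivity.Theorems.DispersionFlow
open Summit.HubbardSuperconductivity.HubbardSuperconductivity.Theorems.EngineV8
open Summit.HubbardSuperconductivity.HubbardSuperconductivity.Theorems.TwoVolumeSource
open Summit.HubbardSuperconductivity.HubbardSuperconductivity.Theorems.TwoVolumeDefect
open Summit.HubbardSuperconductivity.HubbardSuperconductivity.Theorems.TwoPointAssembly

noncomputable section

variable {L b M : ℕ} [NeZero L] [NeZero (b * L)]

/-- **The grid→sector transfer door at the canonical block structures** (nine rows named; `e₁ := klGridBlockEquiv`, `Fe₁ := klGridBlockEmb`, `e₂ := klBlockEquiv`,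
`Fe₂ := klBlockEmb`; the glues `klGridGlue` / `klGlue` recognised by `rfl`). -/
theorem klGridGlue_transfer_le {N₂ : ℕ} (T' : Matrix (SpaceTimeIdx (b * L) M × SectorLeg N₂) (GridLeg (GridPoint (b * L) (klGridN M))) ℂ)
    (T : Matrix (SpaceTimeIdx L M × SectorLeg N₂) (GridLeg (GridPoint L (klGridN M))) ℂ)
    (hP : ∀ (X' : SpaceTimeIdx (b * L) M × SectorLeg N₂) (Y : GridLeg (GridPoint L (klGridN M))),
      ∑ Y'' ∈ univ.filter (fun Y'' : GridLeg (GridPoint (b * L) (klGridN M)) => (klGridBlockEquiv L b M Y'').2 = Y), T' X' Y'' = T (klBlockEquiv L b M N₂ X').2 Y)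
    (W' : GrassmannAlgebra ℂ (GridLeg (GridPoint (b * L) (klGridN M)))) (W : GrassmannAlgebra ℂ (GridLeg (GridPoint L (klGridN M))))
    {n : ℕ} (p : Fin (n + 1)) (w' : SpaceTimeIdx (b * L) M × SectorLeg N₂)
    (Z Near : GridLeg (GridPoint L (klGridN M)) → Prop) [DecidablePred Z] [DecidablePred Near]
    (Far : GridLeg (GridPoint L (klGridN M)) → GridLeg (GridPoint L (klGridN M)) → Prop)
    [DecidableRel Far] (hZ : ∀ y y', Near y → Z y' → Far y y')
    (NearF : GridLeg (GridPoint (b * L) (klGridN M)) → Prop) [DecidablePred NearF]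
    {a τ N Nfar E ND : ℝ} (ha : 0 ≤ a) (hτ0 : 0 ≤ τ) (hN0 : 0 ≤ N) (hNfar0 : 0 ≤ Nfar) (hE0 : 0 ≤ E) (hND0 : 0 ≤ ND)
    (hcol : ∀ y', ∑ x, ‖T' x y'‖ ≤ a)
    (hwin : ∀ (B' : Fin 2 → Fin b) (y : GridLeg (GridPoint L (klGridN M))),
      ∑ B : Fin 2 → Fin b, ∑ x ∈ univ.filter (fun x : SpaceTimeIdx (b * L) M × SectorLeg N₂ =>
          (klBlockEquiv L b M N₂ x).1 = B'),
        ‖T' x ((klGridBlockEquiv L b M).symm (B, y))‖ ≤ a)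
    (hρ : ∑ y, ‖T' w'
        ((klGridBlockEquiv L b M).symm ((klBlockEquiv L b M N₂ w').1, y))‖ ≤ a)
    (hrowF : ∑ y' ∈ univ.filter (fun y' : GridLeg (GridPoint (b * L) (klGridN M)) => NearF y'),
      ‖T' w' y'‖ ≤ a)
    (hτF : ∑ y' ∈ univ.filter (fun y' : GridLeg (GridPoint (b * L) (klGridN M)) => ¬ NearF y'),
      ‖T' w' y'‖ ≤ τ)
    (hτ₁ : ∀ y, ¬ Z y → ∑ x ∈ univ.filter (fun x : SpaceTimeIdx (b * L) M × SectorLeg N₂ =>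
        (klBlockEquiv L b M N₂ x).1 ≠ (klBlockEquiv L b M N₂ w').1),
      ‖T' x
        ((klGridBlockEquiv L b M).symm ((klBlockEquiv L b M N₂ w').1, y))‖ ≤ τ)
    (hτ₂ : ∑ B ∈ univ.erase (klBlockEquiv L b M N₂ w').1, ∑ y,
      ‖T' w' ((klGridBlockEquiv L b M).symm (B, y))‖ ≤ τ)
    (hτ₃ : ∑ y ∈ univ.filter (fun y : GridLeg (GridPoint L (klGridN M)) => ¬ Near y),
      ‖T' w'
        ((klGridBlockEquiv L b M).symm ((klBlockEquiv L b M N₂ w').1, y))‖ ≤ τ)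
    (hτ₄ : ∀ y, ¬ Z y → ∑ B ∈ univ.erase (klBlockEquiv L b M N₂ w').1,
      ∑ x ∈ univ.filter (fun x : SpaceTimeIdx (b * L) M × SectorLeg N₂ =>
          (klBlockEquiv L b M N₂ x).1 = (klBlockEquiv L b M N₂ w').1),
        ‖T' x ((klGridBlockEquiv L b M).symm (B, y))‖ ≤ τ)
    (hN : ∀ y, ∑ Y ∈ univ.filter (fun Y : Fin (n + 1) → GridLeg (GridPoint L (klGridN M)) => Y p = y),
      ‖kernel ℂ W (n + 1) Y‖ ≤ N)
    (hNfar : ∀ y (i : Fin (n + 1)),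
      ∑ Y ∈ univ.filter (fun Y : Fin (n + 1) → GridLeg (GridPoint L (klGridN M)) => Y p = y ∧ Far (Y p) (Y i)),
        ‖kernel ℂ W (n + 1) Y‖ ≤ Nfar)
    (hE : ∀ y', NearF y' →
      ∑ Y' ∈ univ.filter (fun Y' : Fin (n + 1) → GridLeg (GridPoint (b * L) (klGridN M)) => Y' p = y'),
        ‖kernel ℂ (W' - klGridGlue L b M W) (n + 1) Y'‖ ≤ E)
    (hND : ∀ y',
      ∑ Y' ∈ univ.filter (fun Y' : Fin (n + 1) → GridLeg (GridPoint (b * L) (klGridN M)) => Y' p = y'),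
        ‖kernel ℂ (W' - klGridGlue L b M W) (n + 1) Y'‖ ≤ ND) :
    ∑ X' ∈ univ.filter (fun X' : Fin (n + 1) → SpaceTimeIdx (b * L) M × SectorLeg N₂ => X' p = w'),
        ‖kernel ℂ (ExteriorAlgebra.map (Matrix.toLin' T') W' - klGlue L b M N₂ (ExteriorAlgebra.map (Matrix.toLin' T) W)) (n + 1) X'‖ ≤
      a ^ n * (a * E + τ * ND) + (2 * a ^ n * τ * N + n * a ^ n * (5 * τ * N + 2 * a * Nfar)) := by
  have hmain := sum_norm_kernel_map_sub_glue_map_le_of_defect (𝕜 := ℂ) (klGridBlockEquiv L b M) (klBlockEquiv L b M N₂) T T' hP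
    (klGridBlockEmb L b M) (fun B v X' => klGridBlockEmb_apply B v X') (klBlockEmb L b M N₂) (fun B v X' => klBlockEmb_apply B v X')
    W' W p w' Z Near Far hZ NearF ha hτ0 hN0 hNfar0 hE0 hND0 hcol hwin hρ hrowF hτF hτ₁ hτ₂ hτ₃ hτ₄ hN hNfar hE hND
  refine Eq.trans_le (Finset.sum_congr rfl fun X' _ => ?_) hmain
  rw [kernel_sub']
  rfl

set_option maxHeartbeats 400000 in -- the nine transfer data and the door in one declaration
/-- **The grid→sector transfer door from two weighted sums and block covariance** (grid twin of `klGlue_transfer_le_of_wtRows`).  For transfer matrices `T′` (fine) and `T` (coarse) related by the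
periodisation `hP`, with Λ_T-scaled weighted rows and columns of `T′` at most `cW` and `T′` block covariant under `klBlockEquiv`, at a `(D₀ + r)`-deep output pin
`w′` (`2r ≤ D₀`): `Σ_{X′ p = w′} ‖kernel (map (toLin′ T′) W′ − klGlue (map (toLin′ T) W)) X′‖ ≤ cWⁿ(cW·E + τ·ND) + (2cWⁿτN + n·cWⁿ(5τN + 2cW·N_far))`,
`τ = cW/(1 + Λ_T(r+1))`, where `N` is the plain and `N_far` the `r`-far pinned profile of `W`, `E` the profile of the defect `W′ − klGlue W` at pins within `r`
of `w′`, `ND` its global profile — `klGlue_transfer_le` with the nine data of `…TwoVolumeTransferTailsWt` and the triangle inequality of `Torus.tnorm`. -/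
theorem klGridGlue_transfer_le_of_wtRows {N₂ : ℕ} (T' : Matrix (SpaceTimeIdx (b * L) M × SectorLeg N₂) (GridLeg (GridPoint (b * L) (klGridN M))) ℂ)
    (T : Matrix (SpaceTimeIdx L M × SectorLeg N₂) (GridLeg (GridPoint L (klGridN M))) ℂ)
    (hP : ∀ (X' : SpaceTimeIdx (b * L) M × SectorLeg N₂) (Y : GridLeg (GridPoint L (klGridN M))),
      ∑ Y'' ∈ univ.filter (fun Y'' : GridLeg (GridPoint (b * L) (klGridN M)) => (klGridBlockEquiv L b M Y'').2 = Y), T' X' Y'' = T (klBlockEquiv L b M N₂ X').2 Y)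
    {ΛT cW : ℝ} (hΛT : 0 ≤ ΛT) (hcW : 0 ≤ cW)
    (hrow : ∀ x, ∑ y', ‖T' x y'‖ * (1 + ΛT * (Torus.tnorm (x.1.2 - y'.1.1.2) : ℝ)) ≤ cW)
    (hcol : ∀ y', ∑ x, ‖T' x y'‖ * (1 + ΛT * (Torus.tnorm (x.1.2 - y'.1.1.2) : ℝ)) ≤ cW)
    (hcov : ∀ (δ B' B : Fin 2 → Fin b) (xbar : SpaceTimeIdx L M × SectorLeg N₂) (y : GridLeg (GridPoint L (klGridN M))),
      ‖T' ((klBlockEquiv L b M N₂).symm (B' + δ, xbar)) ((klGridBlockEquiv L b M).symm (B + δ, y))‖ =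
        ‖T' ((klBlockEquiv L b M N₂).symm (B', xbar)) ((klGridBlockEquiv L b M).symm (B, y))‖)
    (W' : GrassmannAlgebra ℂ (GridLeg (GridPoint (b * L) (klGridN M)))) (W : GrassmannAlgebra ℂ (GridLeg (GridPoint L (klGridN M))))
    {n : ℕ} (p : Fin (n + 1)) (w' : SpaceTimeIdx (b * L) M × SectorLeg N₂) (D₀ r : ℕ) (hD₀ : 2 * r ≤ D₀)
    (hw : ∀ i, D₀ + r ≤ (w'.1.2 i).val % L ∧ (w'.1.2 i).val % L + (D₀ + r) < L)
    {N Nfar E ND : ℝ} (hN0 : 0 ≤ N) (hNfar0 : 0 ≤ Nfar) (hE0 : 0 ≤ E) (hND0 : 0 ≤ ND)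
    (hN : ∀ y, ∑ Y ∈ univ.filter (fun Y : Fin (n + 1) → GridLeg (GridPoint L (klGridN M)) => Y p = y), ‖kernel ℂ W (n + 1) Y‖ ≤ N)
    (hNfar : ∀ y (i : Fin (n + 1)),
      ∑ Y ∈ univ.filter (fun Y : Fin (n + 1) → GridLeg (GridPoint L (klGridN M)) => Y p = y ∧ r < Torus.tnorm ((Y p).1.1.2 - (Y i).1.1.2)),
        ‖kernel ℂ W (n + 1) Y‖ ≤ Nfar)
    (hE : ∀ y' : GridLeg (GridPoint (b * L) (klGridN M)), Torus.tnorm (w'.1.2 - y'.1.1.2) ≤ r →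
      ∑ Y' ∈ univ.filter (fun Y' : Fin (n + 1) → GridLeg (GridPoint (b * L) (klGridN M)) => Y' p = y'),
        ‖kernel ℂ (W' - klGridGlue L b M W) (n + 1) Y'‖ ≤ E)
    (hND : ∀ y', ∑ Y' ∈ univ.filter (fun Y' : Fin (n + 1) → GridLeg (GridPoint (b * L) (klGridN M)) => Y' p = y'),
      ‖kernel ℂ (W' - klGridGlue L b M W) (n + 1) Y'‖ ≤ ND) :
    ∑ X' ∈ univ.filter (fun X' : Fin (n + 1) → SpaceTimeIdx (b * L) M × SectorLeg N₂ => X' p = w'),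
        ‖kernel ℂ (ExteriorAlgebra.map (Matrix.toLin' T') W' - klGlue L b M N₂ (ExteriorAlgebra.map (Matrix.toLin' T) W)) (n + 1) X'‖ ≤
      cW ^ n * (cW * E + cW / (1 + ΛT * ((r : ℝ) + 1)) * ND) +
        (2 * cW ^ n * (cW / (1 + ΛT * ((r : ℝ) + 1))) * N + n * cW ^ n * (5 * (cW / (1 + ΛT * ((r : ℝ) + 1))) * N + 2 * cW * Nfar)) := by
  classical
  haveI : NeZero b := ⟨fun h => NeZero.ne (b * L) (by rw [h, zero_mul])⟩
  set ed := klBlockEquiv L b M N₂ with hed_def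
  set ed₁ := klGridBlockEquiv L b M with hed₁_def
  have hed1 : ∀ (x : SpaceTimeIdx (b * L) M × SectorLeg N₂) i, ((ed x).1 i : ℕ) = (x.1.2 i).val / L := fun x i => klBlockEquiv_val L b M _ x i
  have hed₁1 : ∀ (y' : GridLeg (GridPoint (b * L) (klGridN M))) i, ((ed₁ y').1 i : ℕ) = (y'.1.1.2 i).val / L := fun y' i => klGridBlockEquiv_val L b M y' i
  have hed2s : ∀ x : SpaceTimeIdx (b * L) M × SectorLeg N₂,
      (fun Y : SpaceTimeIdx L M × SectorLeg N₂ => Y.1.2) (ed x).2 = fun i => ((((x.1.2 i).val : ℕ)) : ZMod L) := fun x => by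
    dsimp only; rw [hed_def, klBlockEquiv_snd]
  have hed₁2s : ∀ y' : GridLeg (GridPoint (b * L) (klGridN M)),
      (fun Y : GridLeg (GridPoint L (klGridN M)) => Y.1.1.2) (ed₁ y').2 = fun i => ((((y'.1.1.2 i).val : ℕ)) : ZMod L) := fun y' => by
    dsimp only; rw [hed₁_def, klGridBlockEquiv_snd]
  -- the nine transfer data (`a := cW`, `τ := cW/(1+Λ_T(r+1))`), regions `R := D₀ + r`, `RN := r`, `RZ := 2r`, `RF := r`
  have hτT : 0 ≤ cW / (1 + ΛT * ((r : ℝ) + 1)) := by positivity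
  have hTcol := transfer_col_le (fun x : SpaceTimeIdx (b * L) M × SectorLeg N₂ => x.1.2) (fun y' : GridLeg (GridPoint (b * L) (klGridN M)) => y'.1.1.2)
    T' hΛT hcol
  have hTwin := transfer_win_le (fun x : SpaceTimeIdx (b * L) M × SectorLeg N₂ => x.1.2) (fun y' : GridLeg (GridPoint (b * L) (klGridN M)) => y'.1.1.2)
    T' hΛT hcol ed ed₁ hcov
  have hTρ := transfer_rho_le (fun x : SpaceTimeIdx (b * L) M × SectorLeg N₂ => x.1.2) (fun y' : GridLeg (GridPoint (b * L) (klGridN M)) => y'.1.1.2)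
    T' hΛT hrow ed ed₁
  have hTrowF := transfer_rowF_le (fun x : SpaceTimeIdx (b * L) M × SectorLeg N₂ => x.1.2) (fun y' : GridLeg (GridPoint (b * L) (klGridN M)) => y'.1.1.2)
    T' hΛT hrow r
  have hTτF := transfer_tauF_le (fun x : SpaceTimeIdx (b * L) M × SectorLeg N₂ => x.1.2) (fun y' : GridLeg (GridPoint (b * L) (klGridN M)) => y'.1.1.2)
    T' hΛT hrow hcW (le_refl r)
  have hTτ2 := transfer_tau2_le (fun x : SpaceTimeIdx (b * L) M × SectorLeg N₂ => x.1.2) (fun y' : GridLeg (GridPoint (b * L) (klGridN M)) => y'.1.1.2)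
    T' hΛT hrow hcW (rfl : b * L = b * L) ed ed₁ hed1 hed₁1 (Nat.le_add_left r D₀) w' hw
  have hTτ3 := transfer_tau3_le (fun x : SpaceTimeIdx (b * L) M × SectorLeg N₂ => x.1.2) (fun y' : GridLeg (GridPoint (b * L) (klGridN M)) => y'.1.1.2)
    T' hΛT hrow hcW (rfl : b * L = b * L) ed ed₁ (fun Y : SpaceTimeIdx L M × SectorLeg N₂ => Y.1.2) (fun Y : GridLeg (GridPoint L (klGridN M)) => Y.1.1.2)
    hed2s hed₁2s (le_refl r) w'
  have hTτ1 := transfer_tau1_le (fun x : SpaceTimeIdx (b * L) M × SectorLeg N₂ => x.1.2) (fun y' : GridLeg (GridPoint (b * L) (klGridN M)) => y'.1.1.2)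
    T' hΛT hcol (rfl : b * L = b * L) ed ed₁ hed1 hed₁1 (fun Y : SpaceTimeIdx L M × SectorLeg N₂ => Y.1.2)
    (fun Y : GridLeg (GridPoint L (klGridN M)) => Y.1.1.2) hed2s hed₁2s (RZ := 2 * r) (by omega : r + 2 * r ≤ D₀ + r) w' hw
  have hTτ4 := transfer_tau4_le (fun x : SpaceTimeIdx (b * L) M × SectorLeg N₂ => x.1.2) (fun y' : GridLeg (GridPoint (b * L) (klGridN M)) => y'.1.1.2)
    T' hΛT hcol (rfl : b * L = b * L) ed ed₁ hed1 hed₁1 (fun Y : SpaceTimeIdx L M × SectorLeg N₂ => Y.1.2)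
    (fun Y : GridLeg (GridPoint L (klGridN M)) => Y.1.1.2) hed2s hed₁2s hcov (RZ := 2 * r) (by omega : r + 2 * r ≤ D₀ + r) w' hw
  -- the triangle `Near y → Z y′ → Far y y′`
  have hZT : ∀ y y' : GridLeg (GridPoint L (klGridN M)), Torus.tnorm ((ed w').2.1.2 - y.1.1.2) ≤ r → 2 * r < Torus.tnorm ((ed w').2.1.2 - y'.1.1.2) →
      r < Torus.tnorm (y.1.1.2 - y'.1.1.2) := by
    intro y y' hy hy'
    have htri := Torus.tnorm_add_le ((ed w').2.1.2 - y.1.1.2) (y.1.1.2 - y'.1.1.2)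
    rw [sub_add_sub_cancel] at htri; omega
  exact klGridGlue_transfer_le T' T hP W' W p w' (fun y => 2 * r < Torus.tnorm ((ed w').2.1.2 - y.1.1.2))
    (fun y => Torus.tnorm ((ed w').2.1.2 - y.1.1.2) ≤ r) (fun y y' => r < Torus.tnorm (y.1.1.2 - y'.1.1.2)) hZT
    (fun y' => Torus.tnorm (w'.1.2 - y'.1.1.2) ≤ r) hcW hτT hN0 hNfar0 hE0 hND0 hTcol hTwin (hTρ w') (hTrowF w') (hTτF w')
    (fun y hy => hTτ1 y hy) hTτ2 (hTτ3) (fun y hy => hTτ4 y hy) hN hNfar hE hND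

/-- **G-4 — THE BASE OBJECT OF THE TWO-VOLUME LIPSCHITZ TOWER AT A DEEP PIN.**  For `0 < β`, a `(D₀+r)`-deep scale-0 output pin `w′` (`2r ≤ D₀`), `(1 + Λ_T·tnorm)`-weighted
row / column sums of the fine base transfer `klLipBaseTransfer (bL)` at most `cW` and its block covariance: the pinned kernel sum of
`BD_base = sectorPreimage F_0(bL) 𝒱⁽⁰⁾(bL) − klGlue (sectorPreimage F_0(L) 𝒱⁽⁰⁾(L))` in degree `n+1` is at most `cWⁿ(cW·E_g + τ·ND_g) + (2cWⁿτN_g + n·cWⁿ(5τN_g + 2cW·N^{far}_g))`,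
`τ = cW/(1+Λ_T(r+1))`, where `N_g`, `N^{far}_g` are the plain / `r`-far profiles of the coarse UV grid action `klGridActionZero L` and `E_g` (grid pins within `r` of `w′`),
`ND_g` (all grid pins) those of the GRID defect `klGridActionZero (bL) − klGridGlue (klGridActionZero L)` — route A's base datum (M4a
`…TwoVolumeScaleZeroTopFrame.hubbardGrid_sum_norm_kernel_twoVolume_stepZero_le` at a common frame). -/
theorem lipBaseDiff_pinned_le [NeZero M] {β : ℝ} (hβ : 0 < β) (U μ : ℝ) (K : TrigPolyC4v) {ΛT cW : ℝ} (hΛT : 0 ≤ ΛT) (hcW : 0 ≤ cW)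
    (hrow : ∀ x, ∑ y', ‖klLipBaseTransfer (b * L) M β μ K x y'‖ * (1 + ΛT * (Torus.tnorm (x.1.2 - y'.1.1.2) : ℝ)) ≤ cW)
    (hcol : ∀ y', ∑ x, ‖klLipBaseTransfer (b * L) M β μ K x y'‖ * (1 + ΛT * (Torus.tnorm (x.1.2 - y'.1.1.2) : ℝ)) ≤ cW)
    (hcov : ∀ (δ B' B : Fin 2 → Fin b) (xbar : SpaceTimeIdx L M × SectorLeg (sectorCount 0)) (y : GridLeg (GridPoint L (klGridN M))),
      ‖klLipBaseTransfer (b * L) M β μ K ((klBlockEquiv L b M (sectorCount 0)).symm (B' + δ, xbar)) ((klGridBlockEquiv L b M).symm (B + δ, y))‖ =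
        ‖klLipBaseTransfer (b * L) M β μ K ((klBlockEquiv L b M (sectorCount 0)).symm (B', xbar)) ((klGridBlockEquiv L b M).symm (B, y))‖)
    {n : ℕ} (p : Fin (n + 1)) (w' : SpaceTimeIdx (b * L) M × SectorLeg (sectorCount 0)) (D₀ r : ℕ) (hD₀ : 2 * r ≤ D₀)
    (hw : ∀ i, D₀ + r ≤ (w'.1.2 i).val % L ∧ (w'.1.2 i).val % L + (D₀ + r) < L)
    {Ng Ngfar Eg NDg : ℝ} (hNg0 : 0 ≤ Ng) (hNgfar0 : 0 ≤ Ngfar) (hEg0 : 0 ≤ Eg) (hNDg0 : 0 ≤ NDg)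
    (hNg : ∀ y, ∑ Y ∈ univ.filter (fun Y : Fin (n + 1) → GridLeg (GridPoint L (klGridN M)) => Y p = y),
      ‖kernel ℂ (klGridActionZero L M β U μ K) (n + 1) Y‖ ≤ Ng)
    (hNgfar : ∀ y (i : Fin (n + 1)),
      ∑ Y ∈ univ.filter (fun Y : Fin (n + 1) → GridLeg (GridPoint L (klGridN M)) => Y p = y ∧ r < Torus.tnorm ((Y p).1.1.2 - (Y i).1.1.2)),
        ‖kernel ℂ (klGridActionZero L M β U μ K) (n + 1) Y‖ ≤ Ngfar)
    (hEg : ∀ y' : GridLeg (GridPoint (b * L) (klGridN M)), Torus.tnorm (w'.1.2 - y'.1.1.2) ≤ r →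
      ∑ Y' ∈ univ.filter (fun Y' : Fin (n + 1) → GridLeg (GridPoint (b * L) (klGridN M)) => Y' p = y'),
        ‖kernel ℂ (klGridActionZero (b * L) M β U μ K - klGridGlue L b M (klGridActionZero L M β U μ K)) (n + 1) Y'‖ ≤ Eg)
    (hNDg : ∀ y', ∑ Y' ∈ univ.filter (fun Y' : Fin (n + 1) → GridLeg (GridPoint (b * L) (klGridN M)) => Y' p = y'),
        ‖kernel ℂ (klGridActionZero (b * L) M β U μ K - klGridGlue L b M (klGridActionZero L M β U μ K)) (n + 1) Y'‖ ≤ NDg) :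
    ∑ X' ∈ univ.filter (fun X' : Fin (n + 1) → SpaceTimeIdx (b * L) M × SectorLeg (sectorCount 0) => X' p = w'),
        ‖kernel ℂ (sectorPreimage β (klAnisoFamily (b * L) M β μ K klE0 0) (klEffectiveAction (b * L) M β U μ K klE0 0) -
            klGlue L b M (sectorCount 0) (sectorPreimage β (klAnisoFamily L M β μ K klE0 0) (klEffectiveAction L M β U μ K klE0 0))) (n + 1) X'‖ ≤
      cW ^ n * (cW * Eg + cW / (1 + ΛT * ((r : ℝ) + 1)) * NDg) +
        (2 * cW ^ n * (cW / (1 + ΛT * ((r : ℝ) + 1))) * Ng + n * cW ^ n * (5 * (cW / (1 + ΛT * ((r : ℝ) + 1))) * Ng + 2 * cW * Ngfar)) := by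
  rw [klLipBaseDiff_eq_transfer_form hβ.ne' U μ K]
  exact klGridGlue_transfer_le_of_wtRows (klLipBaseTransfer (b * L) M β μ K) (klLipBaseTransfer L M β μ K) (klLipBaseTransfer_periodise hβ.ne' μ K) hΛT hcW
    hrow hcol hcov _ _ p w' D₀ r hD₀ hw hNg0 hNgfar0 hEg0 hNDg0 hNg hNgfar hEg hNDg

end

end Summit.HubbardSuperconductivity.HubbardSuperconductivity.Theorems.TwoVolumeLip
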